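import Summits.ValiantsHypothesis.ValiantsHypothesis.Theorems.RigidityForcesSymmetryRankRigidMinimalReprLaplaceResidualReduction
import Summits.ValiantsHypothesis.ValiantsHypothesis.Theorems.RigidityForcesSymmetryRankRigidMinimalReprLaplaceFiveCoreCertified

/-!
# The `a = 3` residual of `LaplaceOptimal 5`: the dual-witness SCHEMA for the two cut types — from
# `(φ₀ ⊥ α₀, φ₁ ∈ V₁(φ₀), kernel line)` to «no decomposition» (crux `RankRigidMinimalRepr`, stmt-18034; rung `LaplaceOptimalFive`, stmt-24813)

Lead file of the three-hand cut (val-lit desk g12 RULING #263 (c)/#265 (b)).  For the two cut types to which the four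
residual configurations reduce (`…LaplaceResidualTransport`) — the TRIANGLE `(0; 01,02,12)` and `(0; 01,02,34)` — the
common tail of val-lit-p8 g11's blueprint (evidence note NOTE-p8g11-24813 §v3) as ONE schema per type, with the
case-dependent inputs as hypotheses:
* `φ₀` killing the slot-`0` slice (`Σ φ₀ α₀ = 0`) — CASE 1: a full-support covector (`exists_fullSupport_orthogonal`);
  CASE 2: `𝟙 − e_a` (val-lit-p3 g14's `indicator_orthogonal`);
* `φ₁` killing the slot-`1` slice and the cut `{0,1}` charged at slot `1` against `φ₀`;
* the KERNEL LINE `hline`: every `φ₂` killing the two-slot bilinear form `F(φ₀,φ₁,·)` lies on a line `ℂ·w` — CASE 1: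
  `fibreSum_kernel_on_line` (FILE 2b); CASE 2: val-lit-p3 g14's `caseTwo_exists_phi1`.
Then **`schema_triangle`** / **`schema_outside`** conclude `¬ [v inj] = Σ slices + Σ pairs`: `φ₂` from the REDUCTION
`exists_orthogonal_not_proportional` (✓ p617102) with `(γ, μ, N) = (α₂, the {0,2}-charge against φ₀, N)`, `N` = the
`φ₀`-contraction of the `{1,2}` cut's cofactor (triangle) resp. the fixed `{3,4}` factor (outside); `(φ₃, φ₄)` from LEMMA C
`bilinear_proportional` (p614067); `per ≠ 0` by `permanent_two_slot`; `LaplaceFiveSlices.refute_of_kills` with p8's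
parameter blocks (verbatim the tails of `triangle_case1` / `outside_case1`, `…LaplaceResidualCase1`).
No definitions.  HONEST FRAMING: `hres` is NOT discharged here (the Case-2 feeds are p3's `triangle_case2`/`outside_case2`,
in flight; the assembly is `…LaplaceResidualAssembly`); 24813/24814/18034 stay OPEN; nothing here bears on `VP ≠ VNP`. [folklore]
-/

set_option autoImplicit false

-- the mandated summit-side namespace repeats a component by design (single-problem summit)
set_option linter.dupNamespace false

namespace Summit.ValiantsHypothesis.ValiantsHypothesis.Theorems.RigidityForcesSymmetryRankRigidMinimalRepr

namespace LaplaceResidual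

open Finset

/-- **SCHEMA, triangle `(0; 01,02,12)`.**  Slices `α k (v k) · W k v` on slots `0,1,2`, pair terms on the cuts
`{0,1}, {0,2}, {1,2}`.  Given `φ₀ ⊥ α₀`, `φ₁ ⊥ α₁` killing the cut `{0,1}` against `φ₀`, and the kernel line of the
two-slot form `F(φ₀,φ₁,·)`, the decomposition identity is impossible. [folklore] -/
theorem schema_triangle (α : Fin 3 → Fin 5 → ℂ) (W : Fin 3 → (Fin 5 → Fin 5) → ℂ)
    (hW : ∀ k, ∀ v v' : Fin 5 → Fin 5, (∀ j, j ≠ (![0, 1, 2] : Fin 3 → Fin 5) k → v j = v' j) → W k v = W k v')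
    (u w : Fin 3 → (Fin 5 → Fin 5) → ℂ)
    (hu : ∀ t, ∀ v v' : Fin 5 → Fin 5, v ((![0, 0, 1] : Fin 3 → Fin 5) t) = v' ((![0, 0, 1] : Fin 3 → Fin 5) t) →
      v ((![1, 2, 2] : Fin 3 → Fin 5) t) = v' ((![1, 2, 2] : Fin 3 → Fin 5) t) → u t v = u t v')
    (hw : ∀ t, ∀ v v' : Fin 5 → Fin 5, (∀ j, j ≠ (![0, 0, 1] : Fin 3 → Fin 5) t →
      j ≠ (![1, 2, 2] : Fin 3 → Fin 5) t → v j = v' j) → w t v = w t v')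
    (φ₀ : Fin 5 → ℂ) (hφ₀α : ∑ c, φ₀ c * α 0 c = 0)
    (φ₁ : Fin 5 → ℂ) (hφ₁β : ∑ c, φ₁ c * α 1 c = 0)
    (hφ₁μ : ∑ y, φ₁ y * ∑ a, φ₀ a * u 0 (Function.update (Function.update (fun _ => (0 : Fin 5)) 0 a) 1 y) = 0)
    (wl : Fin 5 → ℂ)
    (hline : ∀ φ₂ : Fin 5 → ℂ,
      (∀ x y : Fin 5, x ≠ y →
        (∑ τ : Equiv.Perm (Fin 5),
          if τ 3 = x ∧ τ 4 = y then φ₀ (τ 0) * φ₁ (τ 1) * φ₂ (τ 2) else 0) = 0) →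
      ∃ κ : ℂ, ∀ c, φ₂ c = κ * wl c) :
    ¬ ∀ v : Fin 5 → Fin 5, (if Function.Injective v then (1 : ℂ) else 0) =
      (∑ k, α k (v ((![0, 1, 2] : Fin 3 → Fin 5) k)) * W k v) + ∑ t, u t v * w t v := by
  classical
  let c0 : Fin 5 := 0
  let μ₂ : Fin 5 → ℂ := fun y => ∑ a, φ₀ a * u 1 (Function.update (Function.update (fun _ => c0) 0 a) 2 y)
  let N : Fin 5 → Fin 5 → ℂ := fun y z =>
    ∑ x, φ₀ x * w 2 (Function.update (Function.update (Function.update (fun _ => c0) 0 x) 3 y) 4 z)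
  -- φ₂ from the REDUCTION
  obtain ⟨φ₂, hφ₂γ, hφ₂μ, hnot⟩ := exists_orthogonal_not_proportional φ₀ φ₁ wl hline (α 2) μ₂ N
  let M : Fin 5 → Fin 5 → ℂ := fun x y =>
    ∑ σ : Equiv.Perm (Fin 5), if σ 3 = x ∧ σ 4 = y then φ₀ (σ 0) * φ₁ (σ 1) * φ₂ (σ 2) else 0
  -- LEMMA C: covectors for the last two slots
  obtain ⟨φ₃, φ₄, hN0, hM0⟩ : ∃ φ₃ φ₄ : Fin 5 → ℂ, (∑ i, ∑ j, φ₃ i * N i j * φ₄ j) = 0 ∧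
      (∑ i, ∑ j, φ₃ i * M i j * φ₄ j) ≠ 0 := by
    by_contra h
    push Not at h
    exact hnot (bilinear_proportional M N h)
  -- the witness
  let φ : Fin 5 → Fin 5 → ℂ := ![φ₀, φ₁, φ₂, φ₃, φ₄]
  have hφ0 : φ 0 = φ₀ := rfl
  have hφ1 : φ 1 = φ₁ := rfl
  have hφ2 : φ 2 = φ₂ := rfl
  have hφ3 : φ 3 = φ₃ := rfl
  have hφ4 : φ 4 = φ₄ := rfl
  have hper : (Matrix.of fun c s => φ s c).permanent ≠ 0 := by
    rw [permanent_two_slot φ, hφ0, hφ1, hφ2, hφ3, hφ4]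
    exact hM0
  refine LaplaceFiveSlices.refute_of_kills ![0, 1, 2] α W hW ![0, 0, 1] ![1, 2, 2] (by decide) u w hu hw
    ![false, false, true] ![1, 2, 4] ![0, 0, 0] ![0, 0, 0] ![0, 0, 3] ?_ ?_ φ hper ?_ ?_ ?_
  · intro t ht; fin_cases t
    · right; exact ⟨rfl, rfl⟩
    · right; exact ⟨rfl, rfl⟩
    · exact absurd ht (by decide)
  · intro t ht; fin_cases t
    · exact absurd ht (by decide)
    · exact absurd ht (by decide)
    · decide
  · intro k; fin_cases k
    · exact hφ₀α
    · exact hφ₁β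
    · exact hφ₂γ
  · intro t ht; fin_cases t
    · show ∑ y, φ 1 y * ∑ a, φ 0 a * u 0 (Function.update (Function.update (fun _ => (0 : Fin 5)) 0 a) 1 y) = 0
      rw [hφ0, hφ1]; exact hφ₁μ
    · show ∑ y, φ 2 y * ∑ a, φ 0 a * u 1 (Function.update (Function.update (fun _ => (0 : Fin 5)) 0 a) 2 y) = 0
      rw [hφ0, hφ2]; exact hφ₂μ
    · exact absurd ht (by decide)
  · intro t ht; fin_cases t
    · exact absurd ht (by decide)
    · exact absurd ht (by decide)
    · show ∑ z, φ 4 z * ∑ xy : Fin 5 × Fin 5, φ 0 xy.1 * φ 3 xy.2 *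
          w 2 (Function.update (Function.update (Function.update (fun _ => (0 : Fin 5)) 0 xy.1) 3 xy.2) 4 z) = 0
      rw [hφ0, hφ3, hφ4, ← hN0]
      simp only [N, Fintype.sum_prod_type, Fin.sum_univ_five]
      ring

/-- **SCHEMA, `(0; 01,02,34)`.**  Slices on slots `0,1,2`, pair terms on the cuts `{0,1}, {0,2}, {3,4}` (the last one
killed on its 2-slot side by the FIXED factor `u 2`).  Same inputs, same conclusion. [folklore] -/
theorem schema_outside (α : Fin 3 → Fin 5 → ℂ) (W : Fin 3 → (Fin 5 → Fin 5) → ℂ)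
    (hW : ∀ k, ∀ v v' : Fin 5 → Fin 5, (∀ j, j ≠ (![0, 1, 2] : Fin 3 → Fin 5) k → v j = v' j) → W k v = W k v')
    (u w : Fin 3 → (Fin 5 → Fin 5) → ℂ)
    (hu : ∀ t, ∀ v v' : Fin 5 → Fin 5, v ((![0, 0, 3] : Fin 3 → Fin 5) t) = v' ((![0, 0, 3] : Fin 3 → Fin 5) t) →
      v ((![1, 2, 4] : Fin 3 → Fin 5) t) = v' ((![1, 2, 4] : Fin 3 → Fin 5) t) → u t v = u t v')
    (hw : ∀ t, ∀ v v' : Fin 5 → Fin 5, (∀ j, j ≠ (![0, 0, 3] : Fin 3 → Fin 5) t →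
      j ≠ (![1, 2, 4] : Fin 3 → Fin 5) t → v j = v' j) → w t v = w t v')
    (φ₀ : Fin 5 → ℂ) (hφ₀α : ∑ c, φ₀ c * α 0 c = 0)
    (φ₁ : Fin 5 → ℂ) (hφ₁β : ∑ c, φ₁ c * α 1 c = 0)
    (hφ₁μ : ∑ y, φ₁ y * ∑ a, φ₀ a * u 0 (Function.update (Function.update (fun _ => (0 : Fin 5)) 0 a) 1 y) = 0)
    (wl : Fin 5 → ℂ)
    (hline : ∀ φ₂ : Fin 5 → ℂ,
      (∀ x y : Fin 5, x ≠ y →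
        (∑ τ : Equiv.Perm (Fin 5),
          if τ 3 = x ∧ τ 4 = y then φ₀ (τ 0) * φ₁ (τ 1) * φ₂ (τ 2) else 0) = 0) →
      ∃ κ : ℂ, ∀ c, φ₂ c = κ * wl c) :
    ¬ ∀ v : Fin 5 → Fin 5, (if Function.Injective v then (1 : ℂ) else 0) =
      (∑ k, α k (v ((![0, 1, 2] : Fin 3 → Fin 5) k)) * W k v) + ∑ t, u t v * w t v := by
  classical
  let c0 : Fin 5 := 0
  let μ₂ : Fin 5 → ℂ := fun y => ∑ a, φ₀ a * u 1 (Function.update (Function.update (fun _ => c0) 0 a) 2 y)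
  let N : Fin 5 → Fin 5 → ℂ := fun y z => u 2 (Function.update (Function.update (fun _ => c0) 3 y) 4 z)
  obtain ⟨φ₂, hφ₂γ, hφ₂μ, hnot⟩ := exists_orthogonal_not_proportional φ₀ φ₁ wl hline (α 2) μ₂ N
  let M : Fin 5 → Fin 5 → ℂ := fun x y =>
    ∑ σ : Equiv.Perm (Fin 5), if σ 3 = x ∧ σ 4 = y then φ₀ (σ 0) * φ₁ (σ 1) * φ₂ (σ 2) else 0
  obtain ⟨φ₃, φ₄, hN0, hM0⟩ : ∃ φ₃ φ₄ : Fin 5 → ℂ, (∑ i, ∑ j, φ₃ i * N i j * φ₄ j) = 0 ∧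
      (∑ i, ∑ j, φ₃ i * M i j * φ₄ j) ≠ 0 := by
    by_contra h
    push Not at h
    exact hnot (bilinear_proportional M N h)
  let φ : Fin 5 → Fin 5 → ℂ := ![φ₀, φ₁, φ₂, φ₃, φ₄]
  have hφ0 : φ 0 = φ₀ := rfl
  have hφ1 : φ 1 = φ₁ := rfl
  have hφ2 : φ 2 = φ₂ := rfl
  have hφ3 : φ 3 = φ₃ := rfl
  have hφ4 : φ 4 = φ₄ := rfl
  have hper : (Matrix.of fun c s => φ s c).permanent ≠ 0 := by
    rw [permanent_two_slot φ, hφ0, hφ1, hφ2, hφ3, hφ4]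
    exact hM0
  refine LaplaceFiveSlices.refute_of_kills ![0, 1, 2] α W hW ![0, 0, 3] ![1, 2, 4] (by decide) u w hu hw
    ![false, false, false] ![1, 2, 4] ![0, 0, 3] ![0, 0, 0] ![0, 0, 0] ?_ ?_ φ hper ?_ ?_ ?_
  · intro t ht; fin_cases t
    · right; exact ⟨rfl, rfl⟩
    · right; exact ⟨rfl, rfl⟩
    · right; exact ⟨rfl, rfl⟩
  · intro t ht; fin_cases t
    · exact absurd ht (by decide)
    · exact absurd ht (by decide)
    · exact absurd ht (by decide)
  · intro k; fin_cases k
    · exact hφ₀α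
    · exact hφ₁β
    · exact hφ₂γ
  · intro t ht; fin_cases t
    · show ∑ y, φ 1 y * ∑ a, φ 0 a * u 0 (Function.update (Function.update (fun _ => (0 : Fin 5)) 0 a) 1 y) = 0
      rw [hφ0, hφ1]; exact hφ₁μ
    · show ∑ y, φ 2 y * ∑ a, φ 0 a * u 1 (Function.update (Function.update (fun _ => (0 : Fin 5)) 0 a) 2 y) = 0
      rw [hφ0, hφ2]; exact hφ₂μ
    · show ∑ y, φ 4 y * ∑ a, φ 3 a * u 2 (Function.update (Function.update (fun _ => (0 : Fin 5)) 3 a) 4 y) = 0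
      rw [hφ3, hφ4, ← hN0]
      simp only [N, Fin.sum_univ_five]
      ring
  · intro t ht; fin_cases t
    · exact absurd ht (by decide)
    · exact absurd ht (by decide)
    · exact absurd ht (by decide)

end LaplaceResidual

end Summit.ValiantsHypothesis.ValiantsHypothesis.Theorems.RigidityForcesSymmetryRankRigidMinimalRepr
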